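/-
Copyright: cell `pub-ymgap` (HUMAN RULING D-0062), Track A of `YM-PLAN.md`, DAG node N20 (= NE7b); R134 acceleration seat
`pub-ymgap-dag-n20-c` (strategy s1, generation 9), module 49.  Released under the licence of the surrounding project.
-/
import Summits.QuantumFields.YangMills.Theorems.BalabanUVNodesN20LCSInstanceModuloTwo
import Summits.QuantumFields.YangMills.Theorems.BalabanUVNodesN20LCSHullSeparation
import HarnessLib

/-!
# YM-DAG node N20 (= NE7b), row s1, module 49: THE CANONICAL REGULARITY REGION OF A PINNED CUBE — `R♮_k(c)` = the level-`(k+1)` plaquettes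
# sourced in `(□_c^{∼4})^{(k+1)}`: the LOCALITY letter of modules 42–44 holds BY DEFINITION (`r = 4`), the top-scale-cornered plaquettes of
# module 46 §2 lie inside it (so on the pinned event `V′` is `2εreg`-regular there), and the instance-modulo-two (module 48 §3) reads with
# NO free regularity region: (T) = «every minimiser of the (2.16) problem of record at `c` whose datum is `ε(g_{k+1})∕B`-small on `R♮_k(c)` is
# `ε_{k+1}η²`-small on `{p ⊂ □_c^∼}`»

Track A of `YM-PLAN.md` (cell `pub-ymgap`, HUMAN RULING D-0062), node **N20** = spine estimate NE7b (`T4WeightBudget.RelWeightBound`, NOT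
PRINTED, NOT PROVED).  Seat `pub-ymgap-dag-n20-c` (R134, s1), generation 9, module 49 (imports module 48 `…N20LCSInstanceModuloTwo`).  Kernel theorems
only: 0 `def` (the region is the literal `Finset.univ.filter (fun p′ ↦ embIter (k+1) p′.src ∈ cubeEnl … c 4)`), 0 `sorry`, standard axioms; COUNT-NEUTRAL.

WHY.  Modules 18–48 quantify over an ABSTRACT regularity region `R_k c ⊆ Plaq (k+1)` with four letters: LOCALITY (`embIter (k+1) p′.src ∈ cubeEnl (sideχ k) c r`,
modules 42–44), a size bound `#R_k c ≤ m`, pairwise disjointness (or a skeleton, module 48 §3), and `hreg` ∕ (T).  Print's Theorem 1 ([Balaban1985Variational]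
(7)–(9)) asks regularity of the datum on the SUPPORT of the determining set `𝐁_{k+1}(□^{∼4})` — i.e. on the plaquettes of `V′` over `□^{∼4}` (the far
`Γ₀`-data are `εreg·η²`-flat on the solvable set by module 46 §2, automatically).  THIS FILE fixes `R♮_k(c) :=` the level-`(k+1)` plaquettes whose source
embeds into `□_c^{∼4}` and reads the lineage there:
* §1 `mem_canon_iff`; ★ **`locality_canon`** — the LOCALITY letter with `r = 4`, BY DEFINITION; `core_subset_canon` — the top-scale-cornered plaquettes
  (`p′.src ∈ pts (k+1) (maxDomT M₁ □^{∼4} (k+1))`, module 46 §2 ∕ n20-d §2) belong to `R♮_k(c)` (r11's `maxDomT_subset`: `Ω_{k+1} ⊆ Ω = □^{∼4}`);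
  `disjoint_collars_of_far` ∕ ★ `disjoint_canon_of_far` ∕ `disjoint_canon_of_disjoint_collars` — cubes whose base points are `≥ 10·sideχ` apart in some
  coordinate (cyclically; module 42 §1's `coordDist`) have disjoint `4`-collars, hence disjoint canonical regions: the skeleton condition of §4 in def-R's cube
  geometry (module 26's greedy selection runs on «base points `< 10·sideχ` apart in every coordinate»; only the COUNT `K ≤ 19^d` of such neighbours stays displayed).
* §2 ★ **`dist1_lt_on_core_of_chiFactor_eq_zero`** — ON THE PINNED EVENT `χ_{k+1}(c)(V′) = 0` the datum is `2εreg`-REGULAR on the core of `R♮_k(c)`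
  (module 46 §2 restated): (T)'s premise «`ε(g_{k+1})∕B`-small on `R♮`» is asked of a field already `2εreg`-small on the core — the letter's content is the
  gap between `2εreg` and `ε(g_{k+1})∕B`, i.e. GENUINE interior regularity, not a support artefact.
* §3 ★★ **`hreg_canon_of_regularity`** — the lineage's `hreg` at `R♮_k(c)` from (T♮): «every minimiser of the (2.16) problem of record at `c` whose datum
  is `ε″`-small on `R♮_k(c)` is `ε_{k+1}η²`-small on `{p ⊂ □_c^∼}`» (module 46 §4) — THE SHAPE A LOCAL [Balaban1985Variational] Thm 1 (9) EDITION MUST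
  SUPPLY TO N20, with no free region left; `hreg_canon_family_of_regularity`; `hThm1_of_le_epsOfRecord` ((T♮) degenerately inhabited when `εreg ≤ ε_{k+1}`).
* §4 ★★★ **`sum_admS_integral_le_rec_pinnedLevels_in_regime_canon`** — module 48 §3 (skeleton form) AT `R := R♮`: for ANY pinned families `D_j`, a
  `K`-dense skeleton `D′_j ⊆ D_j` whose canonical regions are pairwise disjoint (module 26's `exists_disjoint_subfamily` on §1's «far» relation — `disjoint_canon_of_far`; the neighbour count `K ≤ 19^d` and the size `#R♮ ≤ (9·L·M₂·R_{k+1} + 1)^d·d(d−1)∕2` are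
  DISPLAYED as the hypotheses `hK` ∕ `hm`, counting not typed), (W) on the hull of the skeleton's canonical regions, (T♮) at the skeleton's cubes, regime (R):
  `Σ_{class} ∫ eterm K′ ≤ exp(−(κ∕K)·Σ_j #D_j)·∫ρ₀`.
* §5 ★ **`regime_inhabited`** — the A2 certificate: for any `C ≥ 0`, `B > 0`, `m ≥ 1`, `A₀ > 0` the real side conditions of module 48 §2 ∕ §4 (`α`, the
  averaging guard, `δ`, `a₀`, `0 ≤ X`, the threshold at `γ`, `0 < γ < 1`) are JOINTLY satisfiable (explicit witnesses) — everything displayed except (W), (T♮),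
  the two counts and the run's couplings `0 < g_{j+1} ≤ γ` is inhabited.

HONEST FRAMING.  Bookkeeping over modules 46–48 with one choice (the region) made canonical; no new estimate.  (W) ((A1c), THE wall) and (T♮) ([Balaban1985Variational]
Thm 1 (9) for the LOCAL problem of record — K0's pen; the tree's Theorem-1 socket `B11Thm1CarrierT.varProblemT` is the no-holes global problem) stay DISPLAYED;
the two counts are displayed numerics.  NE7b NOT PRINTED ∕ NOT PROVED; (α)-instance 0∕1; N20 NOT discharged; typed 28∕28, count untouched; one finite
four-torus at fixed `ε` — NOT ℝ⁴, NOT infinite volume, NOT OS, NOT a mass gap, NOT Clay.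

References (LOCATORS): T. Bałaban, CMP 102 (1985) 277–309 [Balaban1985Variational] ((7) p.278, Thm 1 (9) p.279); CMP 119 (1988) 243–285 [Balaban1988Convergent]
((2.13) pp.256–257, (2.16) p.257, (3.2) p.265); CMP 122 (1989) 355–392 [Balaban1989LargeFieldII] ((1.79) p.383).
-/

set_option autoImplicit false

noncomputable section

open scoped BigOperators ENNReal

namespace Summit.QuantumFields.YangMills.BalabanUVNodes.N20LCSCanonicalRegion

open MeasureTheory
open Literature.MathematicalPhysics.QuantumFieldTheory.Balaban1983to89
open Literature.MathematicalPhysics.QuantumFieldTheory.Balaban1983to89.T4Continuum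
open Literature.MathematicalPhysics.QuantumFieldTheory.Balaban1983to89.B14.Eq218Concrete
open Literature.MathematicalPhysics.QuantumFieldTheory.Balaban1983to89.Node00
open B15DeterminingSets B14.Eq213DetSet B14.Eq216Concrete B14.Eq213MaximalDomains B15Eq112TorusCover B14DomainGeom
open Literature.MathematicalPhysics.QuantumFieldTheory.BalabanImbrieJaffe1984to88.BIJ85Eq453GaugeField (qsstarGIter0)
open ExpMeanLog (deltaSU)
open Summit.QuantumFields.BalabanUV.T4Continuum.B16HistoryIndexedRepr (GoodClass)
open Summit.QuantumFields.BalabanUV.T4Continuum.B16HistoryReprChain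
open Summit.QuantumFields.BalabanUV.T4Continuum.NE7b.PrefixExtraction (admS)
open Summit.QuantumFields.YangMills.BalabanUVNodes.N20LCSLabelTower
open Summit.QuantumFields.YangMills.BalabanUVNodes.N20LCSAvgDominationRegion (boxRegion)
open Literature.MathematicalPhysics.QuantumFieldTheory.Balaban1983to89.B15Claim189LambdaPin (coordDist)
open Summit.QuantumFields.YangMills.BalabanUVNodes.N20LCSHullSeparation (coordDist_triangle coordDist_lt_of_mem_cubeEnl)
open Summit.QuantumFields.YangMills.BalabanUVNodes.N20LCSPinnedEventRaw (dist1_lt_near_of_chiFactor_eq_zero hreg_of_regularity)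
open Summit.QuantumFields.YangMills.BalabanUVNodes.N20LCSInstanceModuloTwo (sum_admS_integral_le_rec_pinnedLevels_in_regime_of_skeleton)

variable (F : T4Family) (N : ℕ) [NeZero N] (ν : Stage7Numerics) (M : ℕ) (p : B12.RunParams) (g : ℕ → ℝ)

/-! ## §1 The canonical region: membership, locality by definition, the top-scale core -/

section Region

variable (k : ℕ) (c : Iχ F ν p g k)

open Classical in
/-- Membership in the canonical regularity region `R♮_k(c) = {p′ ∈ Plaq (k+1) | embIter (k+1) p′.src ∈ □_c^{∼4}}`. [cite: Balaban1988Convergent, (2.16) p.257] -/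
theorem mem_canon_iff (p' : Plaq (F.P p.K) (k + 1)) :
    p' ∈ (Finset.univ.filter fun q : Plaq (F.P p.K) (k + 1) => embIter (k + 1) q.src ∈ cubeEnl (F.P p.K) (sideχ F ν p g k) c 4) ↔
      embIter (k + 1) p'.src ∈ cubeEnl (F.P p.K) (sideχ F ν p g k) c 4 := by
  simp only [Finset.mem_filter, Finset.mem_univ, true_and]

open Classical in
/-- ★ **THE LOCALITY LETTER OF MODULES 42–44 HOLDS BY DEFINITION** for the canonical region, with `r = 4`:
`∀ p′ ∈ R♮_k(c), embIter (k+1) p′.src ∈ cubeEnl (sideχ k) c 4`. [cite: Balaban1988Convergent, (2.16) p.257] -/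
theorem locality_canon :
    ∀ p' ∈ (Finset.univ.filter fun q : Plaq (F.P p.K) (k + 1) => embIter (k + 1) q.src ∈ cubeEnl (F.P p.K) (sideχ F ν p g k) c 4),
      embIter (k + 1) p'.src ∈ cubeEnl (F.P p.K) (sideχ F ν p g k) c 4 :=
  fun p' hp' => (mem_canon_iff F ν p g k c p').1 hp'

open Classical in
/-- **THE TOP-SCALE CORE LIES INSIDE**: a plaquette whose source lies in `pts (k+1) (maxDomT M₁ □_c^{∼4} (k+1))` (the top-scale constraint region of the
(2.16) problem, module 46 §2 ∕ n20-d §2) belongs to `R♮_k(c)` — r11's `maxDomT_subset` (`Ω_{k+1} ⊆ Ω = □^{∼4}`, *«with a support in Ω»*), `1 ≤ M₁`.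
[cite: Balaban1988Convergent, (2.13) pp.256–257] -/
theorem core_subset_canon (hM : 1 ≤ ν.M₁) (p' : Plaq (F.P p.K) (k + 1))
    (hp' : p'.src ∈ pts (k + 1) (maxDomT ν.M₁ (cubeEnl (F.P p.K) (sideχ F ν p g k) c 4) (k + 1))) :
    p' ∈ (Finset.univ.filter fun q : Plaq (F.P p.K) (k + 1) => embIter (k + 1) q.src ∈ cubeEnl (F.P p.K) (sideχ F ν p g k) c 4) :=
  (mem_canon_iff F ν p g k c p').2 (maxDomT_subset hM _ _ (mem_pts.1 hp'))

/-- **FAR CUBES HAVE DISJOINT COLLARS** (torus-intrinsic form over module 42 §1's cyclic coordinate distance): if base points `x_a ∈ □_a`, `x_b ∈ □_b` of two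
`s`-cubes are `≥ (n + m + 2)·s` apart in SOME coordinate, the `n`-collar of `□_a` and the `m`-collar of `□_b` are disjoint (triangle inequality + «collars of
one cube are uniformly close»). [cite: Balaban1988Convergent, p.264–265 (the layer calculus)] -/
theorem disjoint_collars_of_far {P : Params} {s : ℕ} {a b : B14DomainGeom.Pt P.d} {xa xb : Site P 0} (hxa : xa ∈ cubeEnl P s a 0)
    (hxb : xb ∈ cubeEnl P s b 0) {n m : ℕ} (hfar : ∃ i, (n + m + 2) * s ≤ coordDist xa xb i) :
    Disjoint (cubeEnl P s a n) (cubeEnl P s b m) := by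
  obtain ⟨i, hi⟩ := hfar
  rw [Set.disjoint_left]
  intro x hx hy
  have h1 := coordDist_lt_of_mem_cubeEnl hxa hx i
  have h2 := coordDist_lt_of_mem_cubeEnl hy hxb i
  have h3 := coordDist_triangle xa x xb i
  have h4 : (0 + n + 1) * s + (m + 0 + 1) * s = (n + m + 2) * s := by ring
  omega

open Classical in
/-- ★ **CUBES `≥ 10` SIDES APART (in some coordinate, cyclically) HAVE DISJOINT CANONICAL REGIONS** — the skeleton condition of §4 ∕ module 48 §3 in def-R's
cube geometry: module 26's greedy `exists_disjoint_subfamily` may run on «base points `< 10·sideχ` apart in every coordinate» as the meeting relation.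
[cite: Balaban1988Convergent, p.264–265, (2.16)–(2.17) p.257] -/
theorem disjoint_canon_of_far {c₁ c₂ : Iχ F ν p g k} {x₁ x₂ : Site (F.P p.K) 0} (hx₁ : x₁ ∈ cubeEnl (F.P p.K) (sideχ F ν p g k) c₁ 0)
    (hx₂ : x₂ ∈ cubeEnl (F.P p.K) (sideχ F ν p g k) c₂ 0) (hfar : ∃ i, 10 * sideχ F ν p g k ≤ coordDist x₁ x₂ i) :
    Disjoint (Finset.univ.filter fun q : Plaq (F.P p.K) (k + 1) => embIter (k + 1) q.src ∈ cubeEnl (F.P p.K) (sideχ F ν p g k) c₁ 4)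
      (Finset.univ.filter fun q : Plaq (F.P p.K) (k + 1) => embIter (k + 1) q.src ∈ cubeEnl (F.P p.K) (sideχ F ν p g k) c₂ 4) := by
  rw [Finset.disjoint_left]
  intro q h₁ h₂
  exact Set.disjoint_left.1 (disjoint_collars_of_far hx₁ hx₂ (n := 4) (m := 4) hfar)
    ((mem_canon_iff F ν p g k c₁ q).1 h₁) ((mem_canon_iff F ν p g k c₂ q).1 h₂)

open Classical in
/-- **DISJOINT COLLARS GIVE DISJOINT CANONICAL REGIONS**: if the `4`-collars `□_{c₁}^{∼4}`, `□_{c₂}^{∼4}` are disjoint point sets of the fine torus, the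
canonical regions of `c₁` and `c₂` are disjoint (the skeleton condition of §4 ∕ module 48 §3 at the level of def-R's cube geometry; module 26's greedy
`exists_disjoint_subfamily` runs on the collars). [cite: Balaban1988Convergent, (2.16)–(2.17) p.257] -/
theorem disjoint_canon_of_disjoint_collars {c₁ c₂ : Iχ F ν p g k}
    (h : Disjoint (cubeEnl (F.P p.K) (sideχ F ν p g k) c₁ 4) (cubeEnl (F.P p.K) (sideχ F ν p g k) c₂ 4)) :
    Disjoint (Finset.univ.filter fun q : Plaq (F.P p.K) (k + 1) => embIter (k + 1) q.src ∈ cubeEnl (F.P p.K) (sideχ F ν p g k) c₁ 4)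
      (Finset.univ.filter fun q : Plaq (F.P p.K) (k + 1) => embIter (k + 1) q.src ∈ cubeEnl (F.P p.K) (sideχ F ν p g k) c₂ 4) := by
  rw [Finset.disjoint_left]
  intro q h₁ h₂
  exact Set.disjoint_left.1 h ((mem_canon_iff F ν p g k c₁ q).1 h₁) ((mem_canon_iff F ν p g k c₂ q).1 h₂)

end Region

/-! ## §2 On the pinned event the datum is `2εreg`-regular on the core of the canonical region -/

section Core

variable (k : ℕ) (c : Iχ F ν p g k) (V' : GaugeField (F.P p.K) (k + 1) (SU N))

open Classical in
/-- ★ **ON THE PINNED EVENT `χ_{k+1}(c)(V′) = 0`, `V′` IS `2εreg`-REGULAR ON THE CORE OF `R♮_k(c)`** (the plaquettes cornered in the top-scale constraint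
region — module 46 §2, via solvability and [Balaban1985Averaging] Prop. 2); so (T♮)'s premise «`ε″`-small on `R♮_k(c)`» is asked of a field that is ALREADY
`2εreg`-small on the core: the letter's content is the gap `2εreg ↘ ε″ = ε(g_{k+1})∕B` — genuine interior regularity, no support artefact.
[cite: Balaban1988Convergent, p.267; Balaban1985Averaging, Prop. 2 (52)–(54) p.26] -/
theorem dist1_lt_on_core_of_chiFactor_eq_zero (hk : k + 1 ≤ (F.P p.K).m + (F.P p.K).K)
    (hε : 0 < epsOfRecord ν g (k + 1) * (F.P p.K).eta (k + 1) ^ 2) (hreg0 : 0 < ν.εreg)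
    (hε3 : (143 * (((((F.P p.K).d + 4 : ℕ) : ℝ)) ^ 2 / 4) ^ 2) * ν.εreg ≤ 1 / 3)
    (hε2 : 2 * ν.εreg ≤ 2 * deltaSU (Fin N) / ((((F.P p.K).d + 4) * (F.P p.K).L : ℕ) : ℝ) ^ 2)
    (h0 : chiFactor F N ν p g k c V' = 0) :
    ∀ p' ∈ (Finset.univ.filter fun q : Plaq (F.P p.K) (k + 1) => embIter (k + 1) q.src ∈ cubeEnl (F.P p.K) (sideχ F ν p g k) c 4),
      p'.src ∈ pts (k + 1) (maxDomT ν.M₁ (cubeEnl (F.P p.K) (sideχ F ν p g k) c 4) (k + 1)) →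
      p'.src.shift p'.μ ∈ pts (k + 1) (maxDomT ν.M₁ (cubeEnl (F.P p.K) (sideχ F ν p g k) c 4) (k + 1)) →
      p'.src.shift p'.ν ∈ pts (k + 1) (maxDomT ν.M₁ (cubeEnl (F.P p.K) (sideχ F ν p g k) c 4) (k + 1)) →
      dist1 (GaugeField.plaqHol V' p') < 2 * ν.εreg :=
  fun p' _ h₀ hμ hν => dist1_lt_near_of_chiFactor_eq_zero F N ν p g k c V' hk hε hreg0 hε3 hε2 h0 p' h₀ hμ hν

end Core

/-! ## §3 The regularity letter at the canonical region from the local Theorem 1 (9) shape -/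

section Hreg

variable (k : ℕ) (c : Iχ F ν p g k)

open Classical in
/-- ★★ **`hreg` AT THE CANONICAL REGION FROM (T♮)** — THE SHAPE A LOCAL [Balaban1985Variational] Thm 1 (9) EDITION MUST SUPPLY TO N20, no free region left:
if every minimiser `U₀` of the (2.16) problem of record at `c` (determining set `𝐁_{k+1}(□_c^{∼4})`, datum `M˙(Q_{k+1}^{s*}V′)`, class `{U | PlaqSmall (εreg·η_{k+1}²) U}`)
whose datum `V′` is `ε″`-small on every level-`(k+1)` plaquette sourced in `(□_c^{∼4})^{(k+1)}` is `ε_{k+1}η²`-small on `{p ⊂ □_c^∼}`, then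
`∀ V′, (∀ p′ ∈ R♮_k(c), |V′(∂p′) − 1| < ε″) → χ_{k+1}(c)(V′) = 1` (module 46 §4 `hreg_of_regularity`). [cite: Balaban1985Variational, Thm 1 (9) p.279] -/
theorem hreg_canon_of_regularity (hε : 0 < epsOfRecord ν g (k + 1) * (F.P p.K).eta (k + 1) ^ 2) (ε'' : ℝ)
    (hThm1 : ∀ (V' : GaugeField (F.P p.K) (k + 1) (SU N)) (U₀ : GaugeField (F.P p.K) 0 (SU N)),
      IsMinimizer (avOfRecord F N p.K) {U | PlaqSmall (ν.εreg * (F.P p.K).eta (k + 1) ^ 2) U}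
          (Bj ν.M₁ (cubeEnl (F.P p.K) (sideχ F ν p g k) c 4) (k + 1)) (avgFamily (avOfRecord F N p.K) (qsstarGIter0 (k + 1) V')) U₀ →
      (∀ p' : Plaq (F.P p.K) (k + 1), embIter (k + 1) p'.src ∈ cubeEnl (F.P p.K) (sideχ F ν p g k) c 4 →
        dist1 (GaugeField.plaqHol V' p') < ε'') →
      PlaqSmallOn (plaqInside (cubeEnl (F.P p.K) (sideχ F ν p g k) c 1)) (epsOfRecord ν g (k + 1) * (F.P p.K).eta (k + 1) ^ 2) U₀) :
    ∀ V' : GaugeField (F.P p.K) (k + 1) (SU N),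
      (∀ p' ∈ (Finset.univ.filter fun q : Plaq (F.P p.K) (k + 1) => embIter (k + 1) q.src ∈ cubeEnl (F.P p.K) (sideχ F ν p g k) c 4),
        dist1 (GaugeField.plaqHol V' p') < ε'') → chiFactor F N ν p g k c V' = 1 :=
  hreg_of_regularity F N ν p g k c hε _ ε'' fun V' U₀ hmin hsmall =>
    hThm1 V' U₀ hmin fun p' hp' => hsmall p' ((mem_canon_iff F ν p g k c p').2 hp')

open Classical in
/-- The family form over pinned cubes `c ∈ D`. [cite: Balaban1985Variational, Thm 1 (9) p.279] -/
theorem hreg_canon_family_of_regularity (hε : 0 < epsOfRecord ν g (k + 1) * (F.P p.K).eta (k + 1) ^ 2) (D : Finset (Iχ F ν p g k)) (ε'' : ℝ)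
    (hThm1 : ∀ c ∈ D, ∀ (V' : GaugeField (F.P p.K) (k + 1) (SU N)) (U₀ : GaugeField (F.P p.K) 0 (SU N)),
      IsMinimizer (avOfRecord F N p.K) {U | PlaqSmall (ν.εreg * (F.P p.K).eta (k + 1) ^ 2) U}
          (Bj ν.M₁ (cubeEnl (F.P p.K) (sideχ F ν p g k) c 4) (k + 1)) (avgFamily (avOfRecord F N p.K) (qsstarGIter0 (k + 1) V')) U₀ →
      (∀ p' : Plaq (F.P p.K) (k + 1), embIter (k + 1) p'.src ∈ cubeEnl (F.P p.K) (sideχ F ν p g k) c 4 →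
        dist1 (GaugeField.plaqHol V' p') < ε'') →
      PlaqSmallOn (plaqInside (cubeEnl (F.P p.K) (sideχ F ν p g k) c 1)) (epsOfRecord ν g (k + 1) * (F.P p.K).eta (k + 1) ^ 2) U₀) :
    ∀ c ∈ D, ∀ V' : GaugeField (F.P p.K) (k + 1) (SU N),
      (∀ p' ∈ (Finset.univ.filter fun q : Plaq (F.P p.K) (k + 1) => embIter (k + 1) q.src ∈ cubeEnl (F.P p.K) (sideχ F ν p g k) c 4),
        dist1 (GaugeField.plaqHol V' p') < ε'') → chiFactor F N ν p g k c V' = 1 :=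
  fun c hc => hreg_canon_of_regularity F N ν p g k c hε ε'' (hThm1 c hc)

/-- **(T♮) IS DEGENERATELY INHABITED**: in the threshold regime `εreg ≤ ε_{k+1}` every minimiser of the problem of record (a member of the class
`{U | PlaqSmall (εreg·η_{k+1}²) U}`) passes the `ε_{k+1}η²`-test everywhere, so (T♮) holds with any `ε″` — the A2 witness for (T♮) (module 24's sanity in
Theorem-1 shape; in print's regime `ε_{k+1} < εreg` and (T♮) is [Balaban1985Variational] Thm 1 (9)). [cite: Balaban1988Convergent, (2.4) p.255, (2.12) p.256] -/
theorem hThm1_of_le_epsOfRecord (hle : ν.εreg ≤ epsOfRecord ν g (k + 1)) (ε'' : ℝ) :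
    ∀ (V' : GaugeField (F.P p.K) (k + 1) (SU N)) (U₀ : GaugeField (F.P p.K) 0 (SU N)),
      IsMinimizer (avOfRecord F N p.K) {U | PlaqSmall (ν.εreg * (F.P p.K).eta (k + 1) ^ 2) U}
          (Bj ν.M₁ (cubeEnl (F.P p.K) (sideχ F ν p g k) c 4) (k + 1)) (avgFamily (avOfRecord F N p.K) (qsstarGIter0 (k + 1) V')) U₀ →
      (∀ p' : Plaq (F.P p.K) (k + 1), embIter (k + 1) p'.src ∈ cubeEnl (F.P p.K) (sideχ F ν p g k) c 4 →
        dist1 (GaugeField.plaqHol V' p') < ε'') →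
      PlaqSmallOn (plaqInside (cubeEnl (F.P p.K) (sideχ F ν p g k) c 1)) (epsOfRecord ν g (k + 1) * (F.P p.K).eta (k + 1) ^ 2) U₀ := by
  intro V' U₀ hmin _ q _
  have h1 : dist1 (GaugeField.plaqHol U₀ q) < ν.εreg * (F.P p.K).eta (k + 1) ^ 2 := hmin.1 q
  exact lt_of_lt_of_le h1 (mul_le_mul_of_nonneg_right hle (sq_nonneg _))

end Hreg

/-! ## §4 The instance modulo two at the canonical regions (module 48 §3 with no free region) -/

section InRegime

variable (A₁ : ℝ)

open Classical in
/-- ★★★ **THE INSTANCE AT THE RECORD MODULO (W) + (T♮) + (R), NO FREE REGULARITY REGION.**  Module 48 §3 at `R_j c := R♮_j(c)`: for ANY pinned families `D_j`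
and a `K`-dense skeleton `D′_j ⊆ D_j` whose canonical regions are pairwise disjoint and of size `≤ m` (displayed counts: `K ≤ 19^d` — cubes with base points `< 10·sideχ` apart in every coordinate —,
`m = (9·L·M₂·R_{j+1} + 1)^d·d(d−1)∕2` suffice — not typed), IF (W) «LCS-j on the hull of the skeleton's canonical regions for window-admissible prefixes»
with level-uniform `C` and (T♮) at the skeleton's cubes, THEN in the regime `0 < g_{j+1} ≤ γ`, `(X∕A₀²)^{1∕(2p₀)} ≤ log γ⁻²`:
`Σ_{h ∈ class K′} ∫ eterm ρ₀ K′ h dμ_{K′} ≤ exp(−(δ·(C·A·M_h² + log m∕δ))∕K · Σ_{j<K′, j∈J} #D_j)·∫ρ₀ dU₀`.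
[cite: Balaban1989LargeFieldII, (1.79) p.383; Balaban1985Variational, Thm 1 (9) p.279] -/
theorem sum_admS_integral_le_rec_pinnedLevels_in_regime_canon {ρ₀ : cfgOfRecord F N p.K 0 → ℝ}
    (hρ : (bddMeas (cfgOfRecord F N p.K 0)).Gd ρ₀) (h0 : ∀ U, 0 ≤ ρ₀ U)
    (J : Finset ℕ) (hJ : ∀ j ∈ J, j < p.K)
    (D D' : (j : ℕ) → Finset (Iχ F ν p g j)) (hsub : ∀ j ∈ J, D' j ⊆ D j) {K : ℕ} (hK1 : 1 ≤ K)
    (hK : ∀ j ∈ J, (D j).card ≤ K * (D' j).card) (m : ℕ) (hm1 : 1 ≤ m)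
    (hm : ∀ j ∈ J, ∀ c ∈ D' j,
      (Finset.univ.filter fun q : Plaq (F.P p.K) (j + 1) => embIter (j + 1) q.src ∈ cubeEnl (F.P p.K) (sideχ F ν p g j) c 4).card ≤ m)
    (hdisj : ∀ j ∈ J, ∀ c₁ ∈ D' j, ∀ c₂ ∈ D' j, c₁ ≠ c₂ →
      Disjoint (Finset.univ.filter fun q : Plaq (F.P p.K) (j + 1) => embIter (j + 1) q.src ∈ cubeEnl (F.P p.K) (sideχ F ν p g j) c₁ 4)
        (Finset.univ.filter fun q : Plaq (F.P p.K) (j + 1) => embIter (j + 1) q.src ∈ cubeEnl (F.P p.K) (sideχ F ν p g j) c₂ 4))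
    {B γ : ℝ} (hB : 0 < B) (hA0 : 0 < ν.A₀) (hp0 : 1 ≤ ν.p₀)
    (hg : ∀ j ∈ J, 0 < g (j + 1) ∧ g (j + 1) ≤ γ)
    (hεη : ∀ j ∈ J, 0 < epsOfRecord ν g (j + 1) * (F.P p.K).eta (j + 1) ^ 2)
    (hThm1 : ∀ j ∈ J, ∀ c ∈ D' j, ∀ (V' : GaugeField (F.P p.K) (j + 1) (SU N)) (U₀ : GaugeField (F.P p.K) 0 (SU N)),
      IsMinimizer (avOfRecord F N p.K) {U | PlaqSmall (ν.εreg * (F.P p.K).eta (j + 1) ^ 2) U}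
          (Bj ν.M₁ (cubeEnl (F.P p.K) (sideχ F ν p g j) c 4) (j + 1)) (avgFamily (avOfRecord F N p.K) (qsstarGIter0 (j + 1) V')) U₀ →
      (∀ p' : Plaq (F.P p.K) (j + 1), embIter (j + 1) p'.src ∈ cubeEnl (F.P p.K) (sideχ F ν p g j) c 4 →
        dist1 (GaugeField.plaqHol V' p') < epsOfRecord ν g (j + 1) / B) →
      PlaqSmallOn (plaqInside (cubeEnl (F.P p.K) (sideχ F ν p g j) c 1)) (epsOfRecord ν g (j + 1) * (F.P p.K).eta (j + 1) ^ 2) U₀)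
    {α C a₀ δ : ℝ} (hα : 0 < α)
    (hguard : (((((F.P p.K).d + 2) * (F.P p.K).L : ℕ) : ℝ) ^ 2 / 4) * Real.sqrt (2 * (Fintype.card (Fin N) : ℝ) * α) < deltaSU (Fin N))
    (hC : 0 ≤ C) (hδ : 0 < δ)
    (hδa : δ * ((2 * (Fintype.card (Fin N) : ℝ) * (((F.P p.K).L : ℝ) ^ 2 + 6 * ((((F.P p.K).d + 2) * (F.P p.K).L : ℕ) : ℝ) ^ 2) ^ 2 +
        2 / α) * (((2 * (((F.P p.K).d + 3) * (F.P p.K).L + 2) + 1) ^ (F.P p.K).d * (F.P p.K).d ^ 2 : ℕ) : ℝ)) ≤ a₀)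
    (hX : 0 ≤ 4 * (Fintype.card (Fin N) : ℝ) * B ^ 2 *
      (C * ((2 * (Fintype.card (Fin N) : ℝ) * (((F.P p.K).L : ℝ) ^ 2 + 6 * ((((F.P p.K).d + 2) * (F.P p.K).L : ℕ) : ℝ) ^ 2) ^ 2 + 2 / α) *
          (((2 * (((F.P p.K).d + 3) * (F.P p.K).L + 2) + 1) ^ (F.P p.K).d * (F.P p.K).d ^ 2 : ℕ) : ℝ)) *
          (((2 * (((F.P p.K).d + 3) * (F.P p.K).L + 2) + 1) ^ (F.P p.K).d * (F.P p.K).d ^ 2 : ℕ) : ℝ) + Real.log m / δ))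
    (hlog : (4 * (Fintype.card (Fin N) : ℝ) * B ^ 2 *
      (C * ((2 * (Fintype.card (Fin N) : ℝ) * (((F.P p.K).L : ℝ) ^ 2 + 6 * ((((F.P p.K).d + 2) * (F.P p.K).L : ℕ) : ℝ) ^ 2) ^ 2 + 2 / α) *
          (((2 * (((F.P p.K).d + 3) * (F.P p.K).L + 2) + 1) ^ (F.P p.K).d * (F.P p.K).d ^ 2 : ℕ) : ℝ)) *
          (((2 * (((F.P p.K).d + 3) * (F.P p.K).L + 2) + 1) ^ (F.P p.K).d * (F.P p.K).d ^ 2 : ℕ) : ℝ) + Real.log m / δ) / ν.A₀ ^ 2) ^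
        ((1 : ℝ) / (2 * ν.p₀)) ≤ Real.log (γ ^ 2)⁻¹)
    (K' : ℕ) (E : (j : ℕ) → (Fin j → LabelPat F ν p g) → Finset (LbOfRecord F ν p g j)) (hE : ∀ j ∈ J, ∀ h t, t ∈ E j h → D j ⊆ t.1)
    (hLSw : ∀ j ∈ J, j < K' → ∀ h : Fin j → LabelPat F ν p g,
      h ∈ admS (labelTowerOfRecord F N ν M p g A₁ (zeta316OfRecord F N ν M A₁)) (labelPattern F ν p g E) j →
      D' j ⊆ cubes32 F ν M p g j (seqOfHist F ν M p g j h) →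
      ∀ a : ℝ, 0 ≤ a → a ≤ a₀ → ∀ X : Finset (Plaq (F.P p.K) j),
        (∀ q ∈ X, ∃ c ∈ D' j,
          ∃ p' ∈ (Finset.univ.filter fun q : Plaq (F.P p.K) (j + 1) => embIter (j + 1) q.src ∈ cubeEnl (F.P p.K) (sideχ F ν p g j) c 4),
            q ∈ boxRegion (emb p'.src) (((F.P p.K).d + 3) * (F.P p.K).L + 2)) →
        ∫ U, Real.exp (a * ((g (j + 1)) ^ 2)⁻¹ * ∑ q ∈ X, (1 - reTr (GaugeField.plaqHol U q))) *
            (labelTowerOfRecord F N ν M p g A₁ (zeta316OfRecord F N ν M A₁)).eterm ρ₀ j h U ∂(lawOfRecord F N p.K j) ≤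
          Real.exp (C * a * X.card) * ∫ U, (labelTowerOfRecord F N ν M p g A₁ (zeta316OfRecord F N ν M A₁)).eterm ρ₀ j h U ∂(lawOfRecord F N p.K j)) :
    ∑ h ∈ admS (labelTowerOfRecord F N ν M p g A₁ (zeta316OfRecord F N ν M A₁)) (labelPattern F ν p g E) K',
        ∫ x, (labelTowerOfRecord F N ν M p g A₁ (zeta316OfRecord F N ν M A₁)).eterm ρ₀ K' h x ∂(lawOfRecord F N p.K K') ≤
      Real.exp (-(δ * (C * ((2 * (Fintype.card (Fin N) : ℝ) * (((F.P p.K).L : ℝ) ^ 2 + 6 * ((((F.P p.K).d + 2) * (F.P p.K).L : ℕ) : ℝ) ^ 2) ^ 2 +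
              2 / α) * (((2 * (((F.P p.K).d + 3) * (F.P p.K).L + 2) + 1) ^ (F.P p.K).d * (F.P p.K).d ^ 2 : ℕ) : ℝ)) *
              (((2 * (((F.P p.K).d + 3) * (F.P p.K).L + 2) + 1) ^ (F.P p.K).d * (F.P p.K).d ^ 2 : ℕ) : ℝ) + Real.log m / δ)) / K *
          ∑ j ∈ (Finset.range K').filter (· ∈ J), ((D j).card : ℝ)) *
        ∫ U, ρ₀ U ∂(fieldMeasure (F.P p.K) 0 (SU N)) :=
  sum_admS_integral_le_rec_pinnedLevels_in_regime_of_skeleton F N ν M p g A₁ hρ h0 J hJ D D' hsub hK1 hK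
    (fun j c => Finset.univ.filter fun q : Plaq (F.P p.K) (j + 1) => embIter (j + 1) q.src ∈ cubeEnl (F.P p.K) (sideχ F ν p g j) c 4)
    m hm1 hm hdisj hB hA0 hp0 hg hεη
    (fun j hj c hc V' U₀ hmin hsmall => hThm1 j hj c hc V' U₀ hmin fun p' hp' =>
      hsmall p' ((mem_canon_iff F ν p g j c p').2 hp'))
    hα hguard hC hδ hδa hX hlog K' E hE hLSw

end InRegime

/-! ## §5 The regime's real side conditions are jointly inhabited (A2 certificate for module 48 §2 ∕ §4 above) -/

section Inhabited

/-- ★ **THE REGIME IS INHABITED**: for any loss constant `C ≥ 0`, Theorem-1 constant `B > 0`, region size `m ≥ 1` and profile constants `A₀ > 0`, `p₀`, there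
are `α, δ, a₀, γ` with `0 < α`, the averaging guard `(((d+2)L)²∕4)·√(2N·α) < δ_SU`, `0 < δ`, `δ·A·M_h ≤ a₀`, `0 ≤ X`, `(X∕A₀²)^{1∕(2p₀)} ≤ log γ⁻²` and `0 < γ < 1`
(`X = 4N·B²·(C·A·M_h·M_h + log m∕δ)`) — so the hypotheses of module 48 §2 ∕ §4 above other than (W), (T♮), the counts and the run's couplings `0 < g_{j+1} ≤ γ`
are jointly satisfiable (witnesses: `α = δ_SU²∕(8N(c+1)²)` with `c = ((d+2)L)²∕4`, `δ = 1`, `a₀ = A·M_h`, `γ = exp(−(t+1)∕2)` with `t = (X∕A₀²)^{1∕(2p₀)}`).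
[folklore] -/
theorem regime_inhabited (C B : ℝ) (m : ℕ) (hC : 0 ≤ C) (hB : 0 < B) (hm : 1 ≤ m) (hA0 : 0 < ν.A₀) :
    ∃ α δ a₀ γ : ℝ, 0 < α ∧
      (((((F.P p.K).d + 2) * (F.P p.K).L : ℕ) : ℝ) ^ 2 / 4) * Real.sqrt (2 * (Fintype.card (Fin N) : ℝ) * α) < deltaSU (Fin N) ∧
      0 < δ ∧
      δ * ((2 * (Fintype.card (Fin N) : ℝ) * (((F.P p.K).L : ℝ) ^ 2 + 6 * ((((F.P p.K).d + 2) * (F.P p.K).L : ℕ) : ℝ) ^ 2) ^ 2 +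
        2 / α) * (((2 * (((F.P p.K).d + 3) * (F.P p.K).L + 2) + 1) ^ (F.P p.K).d * (F.P p.K).d ^ 2 : ℕ) : ℝ)) ≤ a₀ ∧
      0 ≤ 4 * (Fintype.card (Fin N) : ℝ) * B ^ 2 *
        (C * ((2 * (Fintype.card (Fin N) : ℝ) * (((F.P p.K).L : ℝ) ^ 2 + 6 * ((((F.P p.K).d + 2) * (F.P p.K).L : ℕ) : ℝ) ^ 2) ^ 2 + 2 / α) *
            (((2 * (((F.P p.K).d + 3) * (F.P p.K).L + 2) + 1) ^ (F.P p.K).d * (F.P p.K).d ^ 2 : ℕ) : ℝ)) *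
            (((2 * (((F.P p.K).d + 3) * (F.P p.K).L + 2) + 1) ^ (F.P p.K).d * (F.P p.K).d ^ 2 : ℕ) : ℝ) + Real.log m / δ) ∧
      (4 * (Fintype.card (Fin N) : ℝ) * B ^ 2 *
        (C * ((2 * (Fintype.card (Fin N) : ℝ) * (((F.P p.K).L : ℝ) ^ 2 + 6 * ((((F.P p.K).d + 2) * (F.P p.K).L : ℕ) : ℝ) ^ 2) ^ 2 + 2 / α) *
            (((2 * (((F.P p.K).d + 3) * (F.P p.K).L + 2) + 1) ^ (F.P p.K).d * (F.P p.K).d ^ 2 : ℕ) : ℝ)) *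
            (((2 * (((F.P p.K).d + 3) * (F.P p.K).L + 2) + 1) ^ (F.P p.K).d * (F.P p.K).d ^ 2 : ℕ) : ℝ) + Real.log m / δ) / ν.A₀ ^ 2) ^
          ((1 : ℝ) / (2 * ν.p₀)) ≤ Real.log (γ ^ 2)⁻¹ ∧
      0 < γ ∧ γ < 1 := by
  haveI : Nonempty (Fin N) := ⟨⟨0, Nat.pos_of_ne_zero (NeZero.ne N)⟩⟩
  set N' : ℝ := (Fintype.card (Fin N) : ℝ) with hN'
  have hNpos : 0 < N' := by rw [hN', Fintype.card_fin]; exact_mod_cast Nat.pos_of_ne_zero (NeZero.ne N)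
  set c : ℝ := ((((F.P p.K).d + 2) * (F.P p.K).L : ℕ) : ℝ) ^ 2 / 4 with hc
  have hc0 : 0 ≤ c := by positivity
  have hδSU : 0 < deltaSU (Fin N) := ExpMeanLog.deltaSU_pos
  set α : ℝ := deltaSU (Fin N) ^ 2 / (8 * N' * (c + 1) ^ 2) with hα
  have hαpos : 0 < α := by positivity
  set Ad : ℝ := 2 * N' * (((F.P p.K).L : ℝ) ^ 2 + 6 * ((((F.P p.K).d + 2) * (F.P p.K).L : ℕ) : ℝ) ^ 2) ^ 2 + 2 / α with hAd
  set Mh : ℝ := (((2 * (((F.P p.K).d + 3) * (F.P p.K).L + 2) + 1) ^ (F.P p.K).d * (F.P p.K).d ^ 2 : ℕ) : ℝ) with hMh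
  have hAd0 : 0 ≤ Ad := by positivity
  have hMh0 : 0 ≤ Mh := by positivity
  set X : ℝ := 4 * N' * B ^ 2 * (C * (Ad * Mh) * Mh + Real.log m / 1) with hX
  have hlogm : 0 ≤ Real.log m := Real.log_nonneg (by exact_mod_cast hm)
  have hX0 : 0 ≤ X := by positivity
  set t : ℝ := (X / ν.A₀ ^ 2) ^ ((1 : ℝ) / (2 * ν.p₀)) with ht
  have ht0 : 0 ≤ t := Real.rpow_nonneg (by positivity) _
  refine ⟨α, 1, Ad * Mh, Real.exp (-(t + 1) / 2), hαpos, ?_, one_pos, by rw [one_mul], ?_, ?_, Real.exp_pos _, ?_⟩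
  · -- the guard: `c·√(2N′α) = c·δ_SU∕(2(c+1)) < δ_SU`
    have h2 : 2 * N' * α = (deltaSU (Fin N) / (2 * (c + 1))) ^ 2 := by
      rw [hα]; field_simp; ring
    rw [h2, Real.sqrt_sq (by positivity)]
    have h3 : c * (deltaSU (Fin N) / (2 * (c + 1))) = deltaSU (Fin N) * (c / (2 * (c + 1))) := by ring
    rw [h3]
    have h4 : c / (2 * (c + 1)) < 1 := by rw [div_lt_one (by positivity)]; linarith
    calc deltaSU (Fin N) * (c / (2 * (c + 1))) < deltaSU (Fin N) * 1 := mul_lt_mul_of_pos_left h4 hδSU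
      _ = deltaSU (Fin N) := mul_one _
  · -- `0 ≤ X`
    rw [← hX]; exact hX0
  · -- `t ≤ log γ⁻² = t + 1`
    have h5 : (Real.exp (-(t + 1) / 2) ^ 2)⁻¹ = Real.exp (t + 1) := by
      rw [← Real.exp_nat_mul, ← Real.exp_neg]; congr 1; push_cast; ring
    rw [← hX, ← ht, h5, Real.log_exp]
    linarith
  · -- `γ < 1`
    rw [Real.exp_lt_one_iff]
    linarith

end Inhabited

end Summit.QuantumFields.YangMills.BalabanUVNodes.N20LCSCanonicalRegion

end
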